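import Literature.NumberTheory.LFunctions.FordLargeLambdaTailCheck
import Literature.NumberTheory.LFunctions.FordLargeLambdaTailCells1
import Literature.NumberTheory.LFunctions.FordLargeLambdaTailCells2
import Literature.NumberTheory.LFunctions.FordLargeLambdaTailCells3
import Literature.NumberTheory.LFunctions.FordLargeLambdaTailCells4
import Literature.NumberTheory.LFunctions.FordLargeLambdaTailCells5
import Literature.NumberTheory.LFunctions.FordLargeLambdaTailCells6
import Literature.NumberTheory.LFunctions.FordLargeLambdaTailCells7
import Literature.NumberTheory.LFunctions.FordLargeLambdaTailCells8
import Literature.NumberTheory.LFunctions.FordLargeLambdaTailCells9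
import Literature.NumberTheory.LFunctions.FordLargeLambdaTailCells10
import Literature.NumberTheory.LFunctions.FordLargeLambdaTailCells11
import Literature.NumberTheory.LFunctions.FordLargeLambdaTailCells12
import Literature.NumberTheory.LFunctions.FordLargeLambdaTailCells13
import Literature.NumberTheory.LFunctions.FordLargeLambdaTailCells14
import Literature.NumberTheory.LFunctions.FordLargeLambdaTailCells15
import Literature.NumberTheory.LFunctions.FordLargeLambdaTailCells16
import HarnessLib

/-!
# The tail `λ ≥ 2025` of Ford's Theorem 2: side conditions and the final bound

Topic `Literature/NumberTheory/LFunctions`. Everything here is PROVED; no definition, no fact.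

With the parameters of K. Ford, Proc. LMS 85 (2002), §5 ((5.13), (5.16)) at `λ = log t/log N ≥ 2025`
— `k = ⌊λ/κ + 3·10⁻⁶⌋`, `h = ⌊γ₀λ + ½⌋`, `g = ⌊(γ₀+δ₀)λ + ½⌋`, `s = ⌊σh(g−h)⌋ + 1`,
`m_i = ⌊λ/(1−μ_i)⌋`, and (our choice, within Ford's (5.16)) `η = 1/(7g⌊√g⌋)`, `w⁺ = ⌈182g⌊√g⌋/25⌉` —
we discharge the hypotheses `c0`–`c9` of `FordVK.sec5_interval` (`FordLargeLambdaCore.lean`):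
the box-cover lemmas (`Tail.exists_ucell/dcell/wcell`, `Tail.box_point`), the elementary bounds
(`Tail.log_le_root`: `log x ≤ 7.625 + 4(x/2025)^{1/4}`), the constant condition `c8`
(`Tail.tail_c8`: the left side is `≤ 1.155 ≤ log 9.461`; the third summand of the constant of
Theorem 4 is `≤ 0` by Bernoulli's inequality, `Tail.CT4_third_nonpos`), condition (1.10)
(`Tail.tail_c4`), `c5a`, `η ≤ (2/16.3)λ^{-3/2}` (`Tail.tail_eta_le`), the exponent condition
(`Tail.tail_c9`, from the box certificate `Tail.checkAll` of `FordLargeLambdaTailCheck.lean`, whose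
kernel evaluation `Tail.checkAll_true` is assembled from `FordLargeLambdaTailCells*.lean`), and the
integrality conditions; the result is

* `FordVK.Tail.expSum_bound_lambda_ge_2025'` — **Theorem 2 of [Ford2002] for `t ≥ N^{2025}`**:
  `|∑_{N<n≤R₀} (n+u)^{-it}| ≤ 9.463 N^{1 − log²N/(133.66 log²t)}` for `1 ≤ N < R₀ ≤ 2N`, `0 < u ≤ 1`,
  from the rows of (1.7) with `k ≥ 200` (hypothesis `hT3a`, Theorem 3 of the source) and Theorem 4
  of the source (hypothesis `hT4`, verbatim). The range `87 ≤ λ ≤ 2025` is `FordLargeLambda.lean`.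

## References
* K. Ford, Proc. London Math. Soc. (3) 85 (2002), 565–633; arXiv:1910.08209: Theorem 2, §5,
  (5.13)–(5.31), Lemmas 5.2–5.3. [Ford2002]
-/

open Finset Real

namespace Literature.NumberTheory.LFunctions
namespace FordVK
namespace Tail

/-! ### Locating a point of the box in a cell -/

/-- Discrete intermediate value property along a list: if `a/Q ≤ x ≤ (last)/Q` then some
consecutive pair of `a :: l` brackets `x`. [folklore] -/
theorem exists_pair_bracket {Q : ℕ} (hQ : 0 < Q) (x : ℝ) :
    ∀ (l : List ℕ) (a : ℕ), (a : ℝ) / Q ≤ x → x ≤ (((a :: l).getLast (by simp) : ℕ) : ℝ) / Q →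
      l ≠ [] →
      ∃ k : ℕ, k + 1 < (a :: l).length ∧ (((a :: l).getD k 0 : ℕ) : ℝ) / Q ≤ x
        ∧ x ≤ (((a :: l).getD (k + 1) 0 : ℕ) : ℝ) / Q
  | [], a, _, _, hne => absurd rfl hne
  | b :: rest, a, ha, hlast, _ => by
    rcases le_or_gt x ((b : ℝ) / Q) with hb | hb
    · exact ⟨0, by simp, by simpa using ha, by simpa using hb⟩
    · rcases rest with _ | ⟨c, rest'⟩
      · -- `rest = []`: the last element is `b`, contradiction with `x > b/Q`
        simp at hlast
        exact absurd hlast (not_le.2 hb)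
      · have hlast' : x ≤ (((b :: c :: rest').getLast (by simp) : ℕ) : ℝ) / Q := by
          simpa [List.getLast_cons] using hlast
        obtain ⟨k, hk, h1, h2⟩ := exists_pair_bracket hQ x (c :: rest') b hb.le hlast' (by simp)
        exact ⟨k + 1, by simp at hk ⊢; omega, by simpa using h1, by simpa using h2⟩

/-- The `w`-grid brackets every `w ∈ [0, 1/45]` by a cell `l < 50`. [folklore] -/
theorem exists_wcell {w : ℝ} (hw0 : 0 ≤ w) (hw1 : w ≤ 1 / 45) :
    ∃ l : ℕ, l < 50 ∧ ((wgrid.getD l 0 : ℕ) : ℝ) / wQ ≤ w ∧ w ≤ ((wgrid.getD (l + 1) 0 : ℕ) : ℝ) / wQ := by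
  have hQ : 0 < wQ := by unfold wQ; norm_num
  have h := exists_pair_bracket hQ w (wgrid.tail) 0 (by simpa using hw0) ?_ (by decide)
  · have hcons : (0 :: wgrid.tail) = wgrid := by decide
    rw [hcons] at h
    obtain ⟨k, hk, h1, h2⟩ := h
    refine ⟨k, ?_, h1, h2⟩
    have : wgrid.length = 51 := by decide
    omega
  · have : ((0 :: wgrid.tail).getLast (by simp) : ℕ) = 20000 := by decide
    rw [this]; unfold wQ; push_cast; linarith

/-- The `u`-cells cover `[γ₀ − 1/4050, γ₀ + 1/4050]`. [folklore] -/
theorem exists_ucell {u : ℝ} (hu1 : 1.1818 - 1 / 4050 ≤ u) (hu2 : u ≤ 1.1818 + 1 / 4050) :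
    ∃ i : ℕ, i < 16 ∧ ((uLo i : ℤ) : ℝ) / 810000 ≤ u ∧ u ≤ ((uHi i : ℤ) : ℝ) / 810000 := by
  set x : ℝ := (u * 810000 - 957058) / 25 with hx
  have hx0 : 0 ≤ x := by rw [hx]; apply div_nonneg _ (by norm_num); linarith
  have hx16 : x ≤ 16 := by rw [hx, div_le_iff₀ (by norm_num)]; linarith
  set i : ℕ := min 15 ⌊x⌋₊ with hi
  refine ⟨i, by omega, ?_, ?_⟩
  · have h1 : (i : ℝ) ≤ x := by
      have : (i : ℝ) ≤ ⌊x⌋₊ := by exact_mod_cast min_le_right 15 ⌊x⌋₊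
      exact this.trans (Nat.floor_le hx0)
    unfold uLo; push_cast
    rw [div_le_iff₀ (by norm_num)]
    rw [hx] at h1
    have := mul_le_mul_of_nonneg_right h1 (by norm_num : (0:ℝ) ≤ 25)
    linarith [show (u * 810000 - 957058) / 25 * 25 = u * 810000 - 957058 by ring]
  · have h2 : x ≤ (i : ℝ) + 1 := by
      rcases le_or_gt ⌊x⌋₊ 15 with h15 | h15
      · have : i = ⌊x⌋₊ := min_eq_right h15
        rw [this]
        exact (Nat.lt_floor_add_one x).le
      · have : i = 15 := min_eq_left (by omega)
        rw [this]; push_cast; linarith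
    unfold uHi; push_cast
    rw [le_div_iff₀ (by norm_num)]
    rw [hx] at h2
    have := mul_le_mul_of_nonneg_right h2 (by norm_num : (0:ℝ) ≤ 25)
    linarith [show (u * 810000 - 957058) / 25 * 25 = u * 810000 - 957058 by ring]

/-- The `d`-cells cover `[d₀ − 1/2025, d₀ + 1/2025]`, `d₀ = 0.0635`. [folklore] -/
theorem exists_dcell {d : ℝ} (hd1 : 0.0635 - 1 / 2025 ≤ d) (hd2 : d ≤ 0.0635 + 1 / 2025) :
    ∃ j : ℕ, j < 16 ∧ ((dLo j : ℤ) : ℝ) / 810000 ≤ d ∧ d ≤ ((dHi j : ℤ) : ℝ) / 810000 := by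
  set x : ℝ := (d * 810000 - 51035) / 50 with hx
  have hx0 : 0 ≤ x := by rw [hx]; apply div_nonneg _ (by norm_num); linarith
  have hx16 : x ≤ 16 := by rw [hx, div_le_iff₀ (by norm_num)]; linarith
  set j : ℕ := min 15 ⌊x⌋₊ with hj
  refine ⟨j, by omega, ?_, ?_⟩
  · have h1 : (j : ℝ) ≤ x := by
      have : (j : ℝ) ≤ ⌊x⌋₊ := by exact_mod_cast min_le_right 15 ⌊x⌋₊
      exact this.trans (Nat.floor_le hx0)
    unfold dLo; push_cast
    rw [div_le_iff₀ (by norm_num)]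
    rw [hx] at h1
    have := mul_le_mul_of_nonneg_right h1 (by norm_num : (0:ℝ) ≤ 50)
    linarith [show (d * 810000 - 51035) / 50 * 50 = d * 810000 - 51035 by ring]
  · have h2 : x ≤ (j : ℝ) + 1 := by
      rcases le_or_gt ⌊x⌋₊ 15 with h15 | h15
      · have : j = ⌊x⌋₊ := min_eq_right h15
        rw [this]
        exact (Nat.lt_floor_add_one x).le
      · have : j = 15 := min_eq_left (by omega)
        rw [this]; push_cast; linarith
    unfold dHi; push_cast
    rw [le_div_iff₀ (by norm_num)]
    rw [hx] at h2
    have := mul_le_mul_of_nonneg_right h2 (by norm_num : (0:ℝ) ≤ 50)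
    linarith [show (d * 810000 - 51035) / 50 * 50 = d * 810000 - 51035 by ring]

/-- From the whole certificate to one cell. [folklore] -/
theorem checkCell_of_checkAll (h : checkAll = true) {i j l : ℕ} (hi : i < 16) (hj : j < 16) (hl : l < 50) :
    checkCell i j l = true := by
  unfold checkAll nU nD at h
  rw [List.all_eq_true] at h
  have h1 := h i (List.mem_range.2 hi)
  rw [List.all_eq_true] at h1
  have h2 := h1 j (List.mem_range.2 hj)
  rw [List.all_eq_true] at h2
  exact h2 l (List.mem_range.2 hl)

/-- **The box certificate at a point**: for `(u, d, w)` in the box, `n(u,d,w) < 0` and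
`n/den + 10⁻⁷ + 1/133.66 ≤ 0`. [folklore] -/
theorem box_point (h : checkAll = true) {u d w : ℝ}
    (hu1 : 1.1818 - 1 / 4050 ≤ u) (hu2 : u ≤ 1.1818 + 1 / 4050)
    (hd1 : 0.0635 - 1 / 2025 ≤ d) (hd2 : d ≤ 0.0635 + 1 / 2025)
    (hw0 : 0 ≤ w) (hw1 : w ≤ 1 / 45) :
    nf u d w < 0 ∧ nf u d w / denf u d w + 1 / 10000000 + 50 / 6683 ≤ 0 := by
  obtain ⟨i, hi, hiu1, hiu2⟩ := exists_ucell hu1 hu2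
  obtain ⟨j, hj, hjd1, hjd2⟩ := exists_dcell hd1 hd2
  obtain ⟨l, hl, hlw1, hlw2⟩ := exists_wcell hw0 hw1
  exact checkCell_sound (checkCell_of_checkAll h hi hj hl) hiu1 hiu2 hjd1 hjd2 hlw1 hlw2

/-! ### Elementary bounds for the tail -/

/-- `log 2025 ≤ 7.625` (`2025 ≤ 2048 = 2¹¹`). [folklore] -/
theorem log_2025_le : Real.log 2025 ≤ 7.625 := by
  have h1 : Real.log 2025 ≤ Real.log 2048 := Real.log_le_log (by norm_num) (by norm_num)
  have h2 : Real.log 2048 = 11 * Real.log 2 := by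
    rw [show (2048 : ℝ) = 2 ^ 11 by norm_num, Real.log_pow]; norm_num
  have h3 := Real.log_two_lt_d9
  linarith

/-- **`log x ≤ 7.625 + 4ρ`, `ρ = (x/2025)^{1/4} ≥ 1`, for `x ≥ 2025`.** [folklore] -/
theorem log_le_root {x : ℝ} (hx : 2025 ≤ x) :
    Real.log x ≤ 7.625 + 4 * (x / 2025) ^ ((1 : ℝ) / 4) := by
  have hy : 1 ≤ x / 2025 := by rw [le_div_iff₀ (by norm_num)]; linarith
  have h1 : Real.log x = Real.log 2025 + Real.log (x / 2025) := by
    rw [← Real.log_mul (by norm_num) (by positivity)]; congr 1; field_simp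
  have h2 : Real.log (x / 2025) ≤ (x / 2025) ^ ((1 : ℝ) / 4) / (1 / 4) :=
    Real.log_le_rpow_div (by positivity) (by norm_num)
  rw [h1]
  have := log_2025_le
  have h3 : (x / 2025) ^ ((1 : ℝ) / 4) / (1 / 4) = 4 * (x / 2025) ^ ((1 : ℝ) / 4) := by ring
  linarith [h2, h3]

/-- `ρ⁴ = x/2025` and `(45ρ²)² = x`. [folklore] -/
theorem root_props {x : ℝ} (hx : 2025 ≤ x) :
    1 ≤ (x / 2025) ^ ((1 : ℝ) / 4) ∧ ((x / 2025) ^ ((1 : ℝ) / 4)) ^ 4 = x / 2025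
      ∧ Real.sqrt x = 45 * ((x / 2025) ^ ((1 : ℝ) / 4)) ^ 2 := by
  have hx0 : 0 ≤ x := by linarith
  have h1 : 1 ≤ (x / 2025) ^ ((1 : ℝ) / 4) :=
    Real.one_le_rpow (by rw [le_div_iff₀ (by norm_num)]; linarith) (by norm_num)
  have h2 : ((x / 2025) ^ ((1 : ℝ) / 4)) ^ 4 = x / 2025 := by
    rw [← Real.rpow_natCast, ← Real.rpow_mul (by positivity)]; norm_num
  refine ⟨h1, h2, ?_⟩
  have h3 : (45 * ((x / 2025) ^ ((1 : ℝ) / 4)) ^ 2) ^ 2 = x := by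
    rw [mul_pow, ← pow_mul, show 2 * 2 = 4 by rfl, h2]; field_simp; norm_num
  have h4 : Real.sqrt x = Real.sqrt ((45 * ((x / 2025) ^ ((1 : ℝ) / 4)) ^ 2) ^ 2) := by rw [h3]
  rw [h4, Real.sqrt_sq (by positivity)]

/-- `log 9.461 ≥ 2.24`. [folklore] -/
theorem log_9461_ge : 2.24 ≤ Real.log (9.463 - 0.002) := by
  rw [Real.le_log_iff_exp_le (by norm_num)]
  have h1 : Real.exp 2.24 = Real.exp 1 ^ 2 * Real.exp 0.24 := by
    rw [Real.exp_one_pow 2, ← Real.exp_add]; norm_num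
  have h2 : Real.exp 1 ^ 2 ≤ 2.7182818286 ^ 2 :=
    pow_le_pow_left₀ (Real.exp_pos 1).le Real.exp_one_lt_d9.le 2
  have h3 : Real.exp 0.24 ≤ 1.272 := by
    have := Real.exp_bound' (x := 0.24) (by norm_num) (by norm_num) (n := 4) (by norm_num)
    simp only [Finset.sum_range_succ, Finset.sum_range_zero, Nat.factorial] at this
    norm_num at this
    linarith
  rw [h1]
  nlinarith [h2, h3, Real.exp_pos 0.24, show (2.7182818286 : ℝ) ^ 2 * 1.272 ≤ 9.463 - 0.002 by norm_num]

/-! ### The constant condition `c8` for `λ ≥ 2025` -/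

/-- **The third summand of the constant of Theorem 4 is nonpositive** for the tail parameters:
`(1/η + h)(1 − 1/h)^{s/τ} ≥ h` by Bernoulli's inequality, and `log(1/(10η)) ≥ 0`.
[cite: Ford2002, (5.18), (5.29)] -/
theorem CT4_third_nonpos {h g s q η : ℝ} (hh : 54 ≤ h) (hgh : h + 2 ≤ g) (hq : 1 ≤ q)
    (hs1 : 0.3299 * h * (g - h) ≤ s) (hs2 : s ≤ 0.3299 * h * (g - h) + 1) (hη : η * (7 * g * q) = 1) :
    -(s * ((1 / η + h) * (1 - 1 / h) ^ (s / (g - h + 1)) - h) * Real.log (1 / (10 * η))) ≤ 0 := by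
  have hh0 : 0 < h := by linarith
  have hτ0 : 0 < g - h + 1 := by linarith
  have hgh2 : 2 ≤ g - h := by linarith
  have hgq : 0 < 7 * g * q := by nlinarith
  have hηeq : η = 1 / (7 * g * q) := by rw [eq_div_iff hgq.ne']; exact hη
  have hη0 : 0 < η := by rw [hηeq]; positivity
  have hlow : 0.3299 * 54 * (g - h) ≤ 0.3299 * h * (g - h) := by
    have : 0.3299 * 54 ≤ 0.3299 * h := by linarith
    exact mul_le_mul_of_nonneg_right this (by linarith)
  have hs0 : 0 < s := by nlinarith
  -- `p = s/τ ≥ 1`, Bernoulli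
  have hp : 1 ≤ s / (g - h + 1) := by
    rw [le_div_iff₀ hτ0]; nlinarith
  have hbern := one_add_mul_self_le_rpow_one_add (show (-1 : ℝ) ≤ -(1 / h) by
    rw [neg_le_neg_iff, div_le_one hh0]; linarith) hp
  have e1 : (1 : ℝ) + -(1 / h) = 1 - 1 / h := by ring
  rw [e1] at hbern
  -- `s/(τ h) ≤ 0.33`
  have hratio : s / (g - h + 1) * (1 / h) ≤ 0.33 := by
    have e : s / (g - h + 1) * (1 / h) = s / ((g - h + 1) * h) := by field_simp
    rw [e, div_le_iff₀ (by positivity)]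
    have hhg0 : 0 ≤ h * (g - h) := by positivity
    nlinarith [hs2, hhg0]
  have hB : 0.67 ≤ (1 - 1 / h) ^ (s / (g - h + 1)) := by
    have : 1 + s / (g - h + 1) * -(1 / h) = 1 - s / (g - h + 1) * (1 / h) := by ring
    rw [this] at hbern
    linarith
  have hX : 0 ≤ (1 / η + h) * (1 - 1 / h) ^ (s / (g - h + 1)) - h := by
    have h1 : 1 / η = 7 * g * q := by rw [hηeq, one_div_one_div]
    rw [h1]
    have hpow0 : 0 ≤ (1 - 1 / h) ^ (s / (g - h + 1)) := by
      apply Real.rpow_nonneg; rw [sub_nonneg, div_le_one hh0]; linarith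
    -- `(7gq + h) B ≥ 7 g q · 0.67 ≥ 4.69 g ≥ h`
    have hg1 : h ≤ g := by linarith
    have : 0.67 * (7 * g * q) ≤ (7 * g * q + h) * (1 - 1 / h) ^ (s / (g - h + 1)) := by
      nlinarith [hB, hpow0, hgq]
    nlinarith [this, hg1, hq, hh0]
  have hL : 0 ≤ Real.log (1 / (10 * η)) := by
    apply Real.log_nonneg
    rw [hηeq, le_div_iff₀ (by positivity)]
    nlinarith
  have : 0 ≤ s * ((1 / η + h) * (1 - 1 / h) ^ (s / (g - h + 1)) - h) * Real.log (1 / (10 * η)) := by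
    positivity
  linarith

/-! ### The pieces of the constant condition in the tail

Throughout: `λ ≥ 2025`, `ρ = (λ/2025)^{1/4} ≥ 1` (so `√λ = 45ρ²`, `log λ ≤ 7.625 + 4ρ`), and the
parameter bounds `1.5398λ ≤ k ≤ 1.5405λ`, `1.1815λ ≤ h ≤ 1.1821λ`, `1.2450λ ≤ g ≤ 1.2456λ`,
`0.3299h(g−h) ≤ s ≤ 0.3299h(g−h)+1`, `3.21432k² − 1 ≤ r_f ≤ 3.21432k²`, `50 ≤ q`, `q² ≤ g`. -/

/-- Basic consequences of the parameter bounds: `7.62λ² ≤ r_f + 1`, `0.0245λ² ≤ s ≤ 0.025λ² + 1`,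
`g − h + 1 ≤ 0.0646λ`, `1/(2(r_f+1)s) ≤ 2.68/λ⁴`. [folklore] -/
theorem tail_basic {lam k rf h g s : ℝ} (hlam : 2025 ≤ lam)
    (hk1 : 1.5398 * lam ≤ k) (hrf1 : 3.21432 * k ^ 2 - 1 ≤ rf)
    (hh1 : 1.1815 * lam ≤ h) (hh2 : h ≤ 1.1821 * lam)
    (hg1 : 1.2450 * lam ≤ g) (hg2 : g ≤ 1.2456 * lam)
    (hs1 : 0.3299 * h * (g - h) ≤ s) (hs2 : s ≤ 0.3299 * h * (g - h) + 1) :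
    7.62 * lam ^ 2 ≤ rf + 1 ∧ 0.0245 * lam ^ 2 ≤ s ∧ s ≤ 0.025 * lam ^ 2 + 1 ∧ g - h + 1 ≤ 0.0646 * lam
      ∧ 1 / (2 * (rf + 1) * s) ≤ 2.68 / lam ^ 4 := by
  have hlam0 : 0 < lam := by linarith
  have hk0 : 0 ≤ 1.5398 * lam := by positivity
  have hk2' : (1.5398 * lam) ^ 2 ≤ k ^ 2 := pow_le_pow_left₀ hk0 hk1 2
  have hr : 7.62 * lam ^ 2 ≤ rf + 1 := by nlinarith [hk2']
  have hgh1 : 0.0629 * lam ≤ g - h := by linarith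
  have hgh2 : g - h ≤ 0.0641 * lam := by linarith
  have hslo : 0.0245 * lam ^ 2 ≤ s := by
    have h0 : (0 : ℝ) ≤ 0.3299 * h := by linarith
    have : 0.3299 * (1.1815 * lam) * (0.0629 * lam) ≤ 0.3299 * h * (g - h) := by
      apply mul_le_mul (by linarith) hgh1 (by positivity) h0
    nlinarith [this]
  have hshi : s ≤ 0.025 * lam ^ 2 + 1 := by
    have : 0.3299 * h * (g - h) ≤ 0.3299 * (1.1821 * lam) * (0.0641 * lam) := by
      apply mul_le_mul (by linarith) hgh2 (by linarith) (by positivity)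
    nlinarith [this]
  have hτ : g - h + 1 ≤ 0.0646 * lam := by linarith
  refine ⟨hr, hslo, hshi, hτ, ?_⟩
  have hs0 : 0 < s := lt_of_lt_of_le (by positivity) hslo
  have hr0 : 0 < rf + 1 := lt_of_lt_of_le (by positivity) hr
  rw [div_le_div_iff₀ (by positivity) (by positivity)]
  have : 7.62 * lam ^ 2 * (0.0245 * lam ^ 2) ≤ (rf + 1) * s := mul_le_mul hr hslo (by positivity) hr0.le
  nlinarith [this]

/-- The first bracket of `c8`: `(1/(r_f+1))·(w⁺log(208/7) + (w⁺+2)log(w⁺+2) − (w⁺+1) + log(0.1603η)) ≤ 0.70`.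
[cite: Ford2002, (5.28), (5.30)] -/
theorem tail_c8_first {lam rf g q wp η : ℝ} (hlam : 2025 ≤ lam) (hr : 7.62 * lam ^ 2 ≤ rf + 1)
    (hg1 : 1.2450 * lam ≤ g) (hg2 : g ≤ 1.2456 * lam) (hq1 : 50 ≤ q) (hq2 : q ^ 2 ≤ g) (hwp0 : 1 ≤ wp)
    (hwp2 : wp ≤ 182 * g * q / 25 + 1) (hη : η * (7 * g * q) = 1) :
    (1 / (rf + 1)) * (wp * Real.log (208 / 7) + (wp + 2) * Real.log (wp + 2) - (wp + 1)
        + Real.log (η * 0.1603)) ≤ 0.70 := by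
  have hlam0 : 0 < lam := by linarith
  obtain ⟨hρ1, hρ4, hsq⟩ := root_props hlam
  set ρ : ℝ := (lam / 2025) ^ ((1 : ℝ) / 4) with hρ
  have hloglam := log_le_root hlam
  rw [← hρ] at hloglam
  have hlamρ : lam = 2025 * ρ ^ 4 := by rw [hρ4]; field_simp
  have hg0 : 0 < g := by linarith
  have hgq : 0 < 7 * g * q := by positivity
  -- `q ≤ √g ≤ 1.1161 √λ`, `g q ≤ 1.3902 λ √λ`, `w⁺ + 2 ≤ 10.135 λ √λ`
  have hqs : q ≤ Real.sqrt g := (Real.le_sqrt' (by linarith)).2 hq2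
  have hsg : Real.sqrt g ≤ 1.1161 * Real.sqrt lam := by
    rw [show (1.1161 : ℝ) * Real.sqrt lam = Real.sqrt (1.1161 ^ 2 * lam) by
      rw [Real.sqrt_mul' _ hlam0.le, Real.sqrt_sq (by norm_num)]]
    refine Real.sqrt_le_sqrt ?_
    have : (1.1161 : ℝ) ^ 2 = 1.24567921 := by norm_num
    rw [this]; linarith
  have hsl0 : 0 ≤ Real.sqrt lam := Real.sqrt_nonneg _
  have hgq_le : g * q ≤ 1.3903 * lam * Real.sqrt lam := by
    have h1 : q ≤ 1.1161 * Real.sqrt lam := hqs.trans hsg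
    have h2 := mul_le_mul hg2 h1 (by linarith) (by positivity)
    have h3 : 1.2456 * lam * (1.1161 * Real.sqrt lam) ≤ 1.3903 * lam * Real.sqrt lam := by
      have : 0 ≤ lam * Real.sqrt lam := by positivity
      nlinarith [this]
    linarith
  have hW : wp + 2 ≤ 10.135 * lam * Real.sqrt lam := by
    have h45 : 45 ≤ Real.sqrt lam := by rw [hsq]; nlinarith
    have hls : 2025 * 45 ≤ lam * Real.sqrt lam := mul_le_mul hlam h45 (by norm_num) hlam0.le
    linarith [hgq_le, hls]
  have hW0 : 0 < wp + 2 := by linarith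
  -- logarithms
  have hl2 : Real.log 2 ≤ 0.6932 := Real.log_two_lt_d9.le.trans (by norm_num)
  have hlog208 : Real.log (208 / 7) ≤ 3.466 := by
    have : Real.log (208 / 7) ≤ Real.log 32 := Real.log_le_log (by norm_num) (by norm_num)
    rw [show (32 : ℝ) = 2 ^ 5 by norm_num, Real.log_pow] at this
    push_cast at this; linarith
  have hlogW : Real.log (wp + 2) ≤ 14.211 + 6 * ρ := by
    have h1 : Real.log (wp + 2) ≤ Real.log (10.135 * lam * Real.sqrt lam) := Real.log_le_log hW0 hW
    have h2 : Real.log (10.135 * lam * Real.sqrt lam) = Real.log 10.135 + Real.log lam + Real.log (Real.sqrt lam) := by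
      rw [Real.log_mul (by positivity) (by positivity), Real.log_mul (by norm_num) hlam0.ne']
    have h3 : Real.log (Real.sqrt lam) = Real.log lam / 2 := by
      rw [Real.log_sqrt hlam0.le]
    have h4 : Real.log 10.135 ≤ 2.773 := by
      have : Real.log 10.135 ≤ Real.log 16 := Real.log_le_log (by norm_num) (by norm_num)
      rw [show (16 : ℝ) = 2 ^ 4 by norm_num, Real.log_pow] at this
      push_cast at this; linarith
    rw [h2, h3] at h1
    linarith
  have hlogη : Real.log (η * 0.1603) ≤ 0 := by
    apply Real.log_nonpos (by
      have : 0 < η := by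
        have : η = 1 / (7 * g * q) := by rw [eq_div_iff hgq.ne']; exact hη
        rw [this]; positivity
      positivity)
    have : η = 1 / (7 * g * q) := by rw [eq_div_iff hgq.ne']; exact hη
    rw [this, div_mul_eq_mul_div, one_mul, div_le_one hgq]
    nlinarith
  -- the bracket `≤ (w⁺+2)(17.68 + 6ρ) ≤ 10.135 λ√λ · 23.68 ρ = 10800 λ ρ³`
  have hbr : wp * Real.log (208 / 7) + (wp + 2) * Real.log (wp + 2) - (wp + 1) + Real.log (η * 0.1603)
      ≤ (wp + 2) * (17.677 + 6 * ρ) := by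
    have h1 : wp * Real.log (208 / 7) ≤ (wp + 2) * 3.466 := by
      have a := mul_le_mul_of_nonneg_left hlog208 (show (0:ℝ) ≤ wp by linarith)
      have b : (0:ℝ) ≤ Real.log (208 / 7) := Real.log_nonneg (by norm_num)
      nlinarith [a, b]
    have h2 : (wp + 2) * Real.log (wp + 2) ≤ (wp + 2) * (14.211 + 6 * ρ) := mul_le_mul_of_nonneg_left hlogW hW0.le
    linarith
  have hbr2 : (wp + 2) * (17.677 + 6 * ρ) ≤ 10800 * lam * ρ ^ 3 := by
    have h1 : 17.677 + 6 * ρ ≤ 23.677 * ρ := by linarith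
    have h2 : (wp + 2) * (17.677 + 6 * ρ) ≤ (10.135 * lam * Real.sqrt lam) * (23.677 * ρ) :=
      mul_le_mul hW h1 (by positivity) (by positivity)
    rw [hsq] at h2
    have h3 : 10.135 * lam * (45 * ρ ^ 2) * (23.677 * ρ) ≤ 10800 * lam * ρ ^ 3 := by
      have : 0 ≤ lam * ρ ^ 3 := by positivity
      nlinarith [this]
    linarith
  have hr0 : 0 < rf + 1 := lt_of_lt_of_le (by positivity) hr
  calc (1 / (rf + 1)) * (wp * Real.log (208 / 7) + (wp + 2) * Real.log (wp + 2) - (wp + 1)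
        + Real.log (η * 0.1603))
      ≤ (1 / (rf + 1)) * (10800 * lam * ρ ^ 3) :=
        mul_le_mul_of_nonneg_left (hbr.trans hbr2) (by positivity)
    _ ≤ (1 / (7.62 * lam ^ 2)) * (10800 * lam * ρ ^ 3) :=
        mul_le_mul_of_nonneg_right (one_div_le_one_div_of_le (by positivity) hr) (by positivity)
    _ = 10800 / (7.62 * 2025) / ρ := by rw [hlamρ]; field_simp
    _ ≤ 0.70 := (div_le_self (by positivity) hρ1).trans (by norm_num)

/-- The `θk³ log k` term of `c8`: `≤ 0.138`. [cite: Ford2002, (5.27), (5.30)] -/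
theorem tail_c8_theta {lam k W : ℝ} (hlam : 2025 ≤ lam) (hk1 : 1.5398 * lam ≤ k) (hk2 : k ≤ 1.5405 * lam)
    (hW : W ≤ 2.68 / lam ^ 4) :
    W * (2.3291 * k ^ 3 * Real.log k) ≤ 0.138 := by
  have hlam0 : 0 < lam := by linarith
  obtain ⟨hρ1, hρ4, _⟩ := root_props hlam
  set ρ : ℝ := (lam / 2025) ^ ((1 : ℝ) / 4) with hρ
  have hloglam := log_le_root hlam
  rw [← hρ] at hloglam
  have hlamρ : lam = 2025 * ρ ^ 4 := by rw [hρ4]; field_simp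
  have hk0 : 0 < k := by linarith
  have hlogk : Real.log k ≤ 12.17 * ρ := by
    have h1 : Real.log k ≤ Real.log (1.5405 * lam) := Real.log_le_log hk0 hk2
    rw [Real.log_mul (by norm_num) hlam0.ne'] at h1
    have h2 : Real.log 1.5405 ≤ 0.5405 := by
      have := Real.log_le_sub_one_of_pos (show (0:ℝ) < 1.5405 by norm_num); linarith
    linarith
  have hk3 : k ^ 3 ≤ (1.5405 * lam) ^ 3 := pow_le_pow_left₀ hk0.le hk2 3
  have h1 : 2.3291 * k ^ 3 * Real.log k ≤ 2.3291 * (1.5405 * lam) ^ 3 * (12.17 * ρ) := by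
    have hlog0 : 0 ≤ Real.log k := Real.log_nonneg (by linarith)
    apply mul_le_mul (by nlinarith) hlogk hlog0 (by positivity)
  have hpos : 0 ≤ 2.3291 * k ^ 3 * Real.log k := by
    have := Real.log_nonneg (show (1:ℝ) ≤ k by linarith)
    positivity
  calc W * (2.3291 * k ^ 3 * Real.log k) ≤ (2.68 / lam ^ 4) * (2.3291 * (1.5405 * lam) ^ 3 * (12.17 * ρ)) :=
        mul_le_mul hW h1 hpos (by positivity)
    _ = 2.68 * 2.3291 * 1.5405 ^ 3 * 12.17 / 2025 / ρ ^ 3 := by rw [hlamρ]; field_simp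
    _ ≤ 0.138 := by
        rw [div_le_iff₀ (by positivity)]
        have : (1:ℝ) ≤ ρ ^ 3 := one_le_pow₀ hρ1
        nlinarith

/-- The middle summand of the constant of Theorem 4 in `c8`: `W · 10.5τ log²g/(30.57 g η²) ≤ 0.3148`.
[cite: Ford2002, (5.29)] -/
theorem tail_c8_CT4_mid {lam h g q η W : ℝ} (hlam : 2025 ≤ lam)
    (hg1 : 1.2450 * lam ≤ g) (hg2 : g ≤ 1.2456 * lam) (hτ : g - h + 1 ≤ 0.0646 * lam) (hgh : h + 2 ≤ g)
    (hq1 : 50 ≤ q) (hq2 : q ^ 2 ≤ g) (hη : η * (7 * g * q) = 1) (hW : W ≤ 2.68 / lam ^ 4) :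
    W * (10.5 * (g - h + 1) * Real.log g ^ 2 / (30.57 * g * η ^ 2)) ≤ 0.3148 := by
  have hlam0 : 0 < lam := by linarith
  obtain ⟨hρ1, hρ4, _⟩ := root_props hlam
  set ρ : ℝ := (lam / 2025) ^ ((1 : ℝ) / 4) with hρ
  have hloglam := log_le_root hlam
  rw [← hρ] at hloglam
  have hlamρ : lam = 2025 * ρ ^ 4 := by rw [hρ4]; field_simp
  have hg0 : 0 < g := by linarith
  have hτ0 : 0 < g - h + 1 := by linarith
  have hgq : 0 < 7 * g * q := by positivity
  have hηeq : η = 1 / (7 * g * q) := by rw [eq_div_iff hgq.ne']; exact hη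
  have hlogg : Real.log g ≤ 11.871 * ρ := by
    have h1 : Real.log g ≤ Real.log (1.2456 * lam) := Real.log_le_log hg0 hg2
    rw [Real.log_mul (by norm_num) hlam0.ne'] at h1
    have h2 : Real.log 1.2456 ≤ 0.2456 := by
      have := Real.log_le_sub_one_of_pos (show (0:ℝ) < 1.2456 by norm_num); linarith
    linarith
  have hlogg0 : 0 ≤ Real.log g := Real.log_nonneg (by linarith)
  have e : 10.5 * (g - h + 1) * Real.log g ^ 2 / (30.57 * g * η ^ 2)
      = 10.5 / 30.57 * 49 * ((g - h + 1) * g * q ^ 2 * Real.log g ^ 2) := by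
    rw [hηeq]; field_simp; ring
  have hX : (g - h + 1) * g * q ^ 2 * Real.log g ^ 2
      ≤ (0.0646 * lam) * (1.2456 * lam) * (1.2456 * lam) * (11.871 * ρ) ^ 2 := by
    have hl2 : Real.log g ^ 2 ≤ (11.871 * ρ) ^ 2 := pow_le_pow_left₀ hlogg0 hlogg 2
    have hq2' : q ^ 2 ≤ 1.2456 * lam := hq2.trans hg2
    have a1 : (g - h + 1) * g ≤ (0.0646 * lam) * (1.2456 * lam) := mul_le_mul hτ hg2 hg0.le (by positivity)
    have a2 : (g - h + 1) * g * q ^ 2 ≤ (0.0646 * lam) * (1.2456 * lam) * (1.2456 * lam) :=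
      mul_le_mul a1 hq2' (by positivity) (by positivity)
    exact mul_le_mul a2 hl2 (by positivity) (by positivity)
  have hX0 : 0 ≤ (g - h + 1) * g * q ^ 2 * Real.log g ^ 2 := by positivity
  have hsecond : 10.5 * (g - h + 1) * Real.log g ^ 2 / (30.57 * g * η ^ 2) ≤ 237.8 * ρ ^ 2 * lam ^ 3 := by
    rw [e]
    have c1 : (10.5 : ℝ) / 30.57 * 49 ≤ 16.831 := by norm_num
    have c2 : 10.5 / 30.57 * 49 * ((g - h + 1) * g * q ^ 2 * Real.log g ^ 2)
        ≤ 16.831 * ((0.0646 * lam) * (1.2456 * lam) * (1.2456 * lam) * (11.871 * ρ) ^ 2) :=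
      mul_le_mul c1 hX hX0 (by norm_num)
    have c3 : 16.831 * ((0.0646 * lam) * (1.2456 * lam) * (1.2456 * lam) * (11.871 * ρ) ^ 2)
        ≤ 237.8 * ρ ^ 2 * lam ^ 3 := by
      have : 0 ≤ ρ ^ 2 * lam ^ 3 := by positivity
      nlinarith [this]
    linarith
  have hpos : 0 ≤ 10.5 * (g - h + 1) * Real.log g ^ 2 / (30.57 * g * η ^ 2) := by
    rw [e]; positivity
  calc W * (10.5 * (g - h + 1) * Real.log g ^ 2 / (30.57 * g * η ^ 2))
      ≤ (2.68 / lam ^ 4) * (237.8 * ρ ^ 2 * lam ^ 3) := mul_le_mul hW hsecond hpos (by positivity)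
    _ = 2.68 * 237.8 / 2025 / ρ ^ 2 := by rw [hlamρ]; field_simp
    _ ≤ 0.3148 := by
        have h1 : 2.68 * 237.8 / 2025 / ρ ^ 2 ≤ 2.68 * 237.8 / 2025 := div_le_self (by positivity) (one_le_pow₀ hρ1)
        exact h1.trans (by norm_num)

/-- The constant of Theorem 4 in `c8`: `W·C ≤ 0.316`. [cite: Ford2002, (5.29), (5.30)] -/
theorem tail_c8_CT4 {lam rf h g s q η W : ℝ} (hlam : 2025 ≤ lam) (hr : 7.62 * lam ^ 2 ≤ rf + 1)
    (hh1 : 1.1815 * lam ≤ h) (hh2 : h ≤ 1.1821 * lam) (hg1 : 1.2450 * lam ≤ g) (hg2 : g ≤ 1.2456 * lam)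
    (hτ : g - h + 1 ≤ 0.0646 * lam) (hgh : h + 2 ≤ g)
    (hs1 : 0.3299 * h * (g - h) ≤ s) (hs2 : s ≤ 0.3299 * h * (g - h) + 1) (hshi : s ≤ 0.025 * lam ^ 2 + 1)
    (hq1 : 50 ≤ q) (hq2 : q ^ 2 ≤ g) (hη : η * (7 * g * q) = 1)
    (hWdef : W = 1 / (2 * (rf + 1) * s)) (hW : W ≤ 2.68 / lam ^ 4) :
    W * ((s ^ 2 / (g - h + 1)
        + 10.5 * (g - h + 1) * Real.log g ^ 2 / (30.57 * g * η ^ 2)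
        - s * ((1 / η + h) * (1 - 1 / h) ^ (s / (g - h + 1)) - h) * Real.log (1 / (10 * η))))
      ≤ 0.316 := by
  have hlam0 : 0 < lam := by linarith
  have hg0 : 0 < g := by linarith
  have hτ0 : 0 < g - h + 1 := by linarith
  have hs0 : 0 < s := lt_of_lt_of_le (by nlinarith) hs1
  have hr0 : 0 < rf + 1 := lt_of_lt_of_le (by positivity) hr
  have hW0 : 0 ≤ W := by rw [hWdef]; positivity
  -- third term `≤ 0`
  have hthird := CT4_third_nonpos (by linarith) hgh (by linarith) hs1 hs2 hη
  -- first term: `W s²/τ = s/(2(rf+1)τ) ≤ tiny`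
  have hfirst : W * (s ^ 2 / (g - h + 1)) ≤ 0.0001 := by
    have hτ128 : 128 ≤ g - h + 1 := by linarith
    have e : W * (s ^ 2 / (g - h + 1)) = s / (2 * (rf + 1) * (g - h + 1)) := by
      rw [hWdef]; field_simp
    rw [e, div_le_iff₀ (by positivity)]
    nlinarith [mul_le_mul hr hτ128 (by norm_num) hr0.le]
  have hsecond' := tail_c8_CT4_mid hlam hg1 hg2 hτ hgh hq1 hq2 hη hW
  have hthird' : W * (-(s * ((1 / η + h) * (1 - 1 / h) ^ (s / (g - h + 1)) - h) * Real.log (1 / (10 * η)))) ≤ 0 :=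
    mul_nonpos_of_nonneg_of_nonpos hW0 hthird
  have e : W * ((s ^ 2 / (g - h + 1)
        + 10.5 * (g - h + 1) * Real.log g ^ 2 / (30.57 * g * η ^ 2)
        - s * ((1 / η + h) * (1 - 1 / h) ^ (s / (g - h + 1)) - h) * Real.log (1 / (10 * η))))
      = W * (s ^ 2 / (g - h + 1)) + W * (10.5 * (g - h + 1) * Real.log g ^ 2 / (30.57 * g * η ^ 2))
        + W * (-(s * ((1 / η + h) * (1 - 1 / h) ^ (s / (g - h + 1)) - h) * Real.log (1 / (10 * η)))) := by
    ring
  rw [e]; linarith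

/-- `0 ≤ log(5(r_f+1)) ≤ 52.45 + 8λ/2025`. [folklore] -/
theorem tail_log_5r {lam k rf : ℝ} (hlam : 2025 ≤ lam) (hk1 : 1.5398 * lam ≤ k) (hk2 : k ≤ 1.5405 * lam)
    (hrf2 : rf ≤ 3.21432 * k ^ 2) (hr : 7.62 * lam ^ 2 ≤ rf + 1) :
    0 ≤ Real.log (5 * (rf + 1)) ∧ Real.log (5 * (rf + 1)) ≤ 52.45 + 8 * (lam / 2025) := by
  have hlam0 : 0 < lam := by linarith
  obtain ⟨hρ1, hρ4, _⟩ := root_props hlam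
  set ρ : ℝ := (lam / 2025) ^ ((1 : ℝ) / 4) with hρ
  have hloglam := log_le_root hlam
  rw [← hρ] at hloglam
  have hk0 : 0 < k := by linarith
  have hρle : ρ ≤ lam / 2025 := by
    rw [← hρ4]
    calc ρ = ρ * 1 := (mul_one ρ).symm
      _ ≤ ρ * ρ ^ 3 := mul_le_mul_of_nonneg_left (one_le_pow₀ hρ1) (by linarith)
      _ = ρ ^ 4 := by ring
  have hrf' : rf + 1 ≤ 7.64 * lam ^ 2 := by nlinarith [pow_le_pow_left₀ hk0.le hk2 2]
  refine ⟨Real.log_nonneg (by nlinarith), ?_⟩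
  have h1 : Real.log (5 * (rf + 1)) ≤ Real.log (38.2 * lam ^ 2) :=
    Real.log_le_log (by nlinarith) (by nlinarith)
  have h2 : Real.log (38.2 * lam ^ 2) = Real.log 38.2 + 2 * Real.log lam := by
    rw [Real.log_mul (by norm_num) (by positivity), Real.log_pow]; push_cast; ring
  have h3 : Real.log 38.2 ≤ 37.2 := by
    have := Real.log_le_sub_one_of_pos (show (0:ℝ) < 38.2 by norm_num); linarith
  linarith

/-- `0 ≤ log(16 g 4^g s) ≤ 2.9725λ + 0.025λ² + 16`. [folklore] -/
theorem tail_log_16g {lam g s F : ℝ} (hlam : 2025 ≤ lam) (hg1 : 1.2450 * lam ≤ g) (hg2 : g ≤ 1.2456 * lam)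
    (hs0 : 1 ≤ s) (hshi : s ≤ 0.025 * lam ^ 2 + 1) (hF0 : 0 < F) (hF : Real.log F = g * Real.log 4) :
    0 ≤ Real.log (16 * g * F * s) ∧ Real.log (16 * g * F * s) ≤ 2.9725 * lam + 0.025 * lam ^ 2 + 16 := by
  have hg0 : 0 < g := by linarith
  have hl2 : Real.log 2 ≤ 0.6932 := Real.log_two_lt_d9.le.trans (by norm_num)
  have hF1 : 1 ≤ F := by
    have : 0 ≤ Real.log F := by rw [hF]; exact mul_nonneg hg0.le (Real.log_nonneg (by norm_num))
    rwa [Real.log_nonneg_iff hF0] at this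
  refine ⟨Real.log_nonneg ?_, ?_⟩
  · have a : (1:ℝ) ≤ 16 * g := by linarith
    have b : (1:ℝ) ≤ 16 * g * F := by nlinarith
    nlinarith
  rw [Real.log_mul (by positivity) (by positivity), Real.log_mul (by positivity) hF0.ne',
    Real.log_mul (by norm_num) hg0.ne', hF]
  have a1 : Real.log 16 ≤ 15 := by
    have := Real.log_le_sub_one_of_pos (show (0:ℝ) < 16 by norm_num); linarith
  have a2 : Real.log g ≤ g - 1 := Real.log_le_sub_one_of_pos hg0
  have a3 : Real.log s ≤ s - 1 := Real.log_le_sub_one_of_pos (by linarith)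
  have a4 : Real.log 4 ≤ 1.3864 := by
    rw [show (4:ℝ) = 2 ^ 2 by norm_num, Real.log_pow]; push_cast; linarith
  have a5 : g * Real.log 4 ≤ g * 1.3864 := mul_le_mul_of_nonneg_left a4 hg0.le
  nlinarith

/-- The last two terms of `c8`: `W·(k log(5(r_f+1)) + τ log(16 g 4^g s)) ≤ 0.001`. [cite: Ford2002, (5.20), (5.30)] -/
theorem tail_c8_rest {lam k rf h g s F W : ℝ} (hlam : 2025 ≤ lam) (hk1 : 1.5398 * lam ≤ k) (hk2 : k ≤ 1.5405 * lam)
    (hrf2 : rf ≤ 3.21432 * k ^ 2) (hr : 7.62 * lam ^ 2 ≤ rf + 1)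
    (hg1 : 1.2450 * lam ≤ g) (hg2 : g ≤ 1.2456 * lam) (hτ : g - h + 1 ≤ 0.0646 * lam)
    (hgh : h + 2 ≤ g) (hs0 : 1 ≤ s) (hshi : s ≤ 0.025 * lam ^ 2 + 1) (hF0 : 0 < F) (hF : Real.log F = g * Real.log 4)
    (hW : W ≤ 2.68 / lam ^ 4) :
    W * (k * Real.log (5 * (rf + 1)) + (g - h + 1) * Real.log (16 * g * F * s)) ≤ 0.001 := by
  have hlam0 : 0 < lam := by linarith
  have hk0 : 0 < k := by linarith
  obtain ⟨hl1a, hl1b⟩ := tail_log_5r hlam hk1 hk2 hrf2 hr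
  obtain ⟨hl2a, hl2b⟩ := tail_log_16g hlam hg1 hg2 hs0 hshi hF0 hF
  have b1 : k * Real.log (5 * (rf + 1)) ≤ (1.5405 * lam) * (52.45 + 8 * (lam / 2025)) :=
    mul_le_mul hk2 hl1b hl1a (by positivity)
  have b2 : (g - h + 1) * Real.log (16 * g * F * s) ≤ (0.0646 * lam) * (2.9725 * lam + 0.025 * lam ^ 2 + 16) :=
    mul_le_mul hτ hl2b hl2a (by positivity)
  have hsum : k * Real.log (5 * (rf + 1)) + (g - h + 1) * Real.log (16 * g * F * s) ≤ 0.00175 * lam ^ 3 := by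
    have q1 : 0 ≤ 0.000135 * lam ^ 2 - 0.19811 * lam - 81.83 := by
      nlinarith [mul_nonneg (sub_nonneg.2 hlam) (sub_nonneg.2 hlam)]
    have q2 := mul_nonneg hlam0.le q1
    have : (1.5405 * lam) * (52.45 + 8 * (lam / 2025)) + (0.0646 * lam) * (2.9725 * lam + 0.025 * lam ^ 2 + 16)
        ≤ 0.00175 * lam ^ 3 := by nlinarith [q2]
    linarith
  have hsum0 : 0 ≤ k * Real.log (5 * (rf + 1)) + (g - h + 1) * Real.log (16 * g * F * s) := by
    have t1 : 0 ≤ k * Real.log (5 * (rf + 1)) := mul_nonneg hk0.le hl1a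
    have t2 : 0 ≤ (g - h + 1) * Real.log (16 * g * F * s) := mul_nonneg (by linarith) hl2a
    linarith
  calc W * (k * Real.log (5 * (rf + 1)) + (g - h + 1) * Real.log (16 * g * F * s))
      ≤ (2.68 / lam ^ 4) * (0.00175 * lam ^ 3) := mul_le_mul hW hsum hsum0 (by positivity)
    _ = 2.68 * 0.00175 / lam := by field_simp
    _ ≤ 0.001 := by rw [div_le_iff₀ hlam0]; nlinarith

/-- **The constant condition `c8` in the tail `λ ≥ 2025`**: the left side is `≤ 1.155 ≤ log 9.461`.
[cite: Ford2002, (5.30)] -/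
theorem tail_c8 {lam k rf h g s q wp η F : ℝ} (hlam : 2025 ≤ lam)
    (hk1 : 1.5398 * lam ≤ k) (hk2 : k ≤ 1.5405 * lam)
    (hrf1 : 3.21432 * k ^ 2 - 1 ≤ rf) (hrf2 : rf ≤ 3.21432 * k ^ 2)
    (hh1 : 1.1815 * lam ≤ h) (hh2 : h ≤ 1.1821 * lam)
    (hg1 : 1.2450 * lam ≤ g) (hg2 : g ≤ 1.2456 * lam)
    (hs1 : 0.3299 * h * (g - h) ≤ s) (hs2 : s ≤ 0.3299 * h * (g - h) + 1)
    (hq1 : 50 ≤ q) (hq2 : q ^ 2 ≤ g) (hwp0 : 1 ≤ wp) (hwp2 : wp ≤ 182 * g * q / 25 + 1)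
    (hη : η * (7 * g * q) = 1) (hF0 : 0 < F) (hF : Real.log F = g * Real.log 4) :
    (1 / (rf + 1)) * (wp * Real.log (208 / 7) + (wp + 2) * Real.log (wp + 2) - (wp + 1)
        + Real.log (η * 0.1603))
      + (1 / (2 * (rf + 1) * s)) * (2.3291 * k ^ 3 * Real.log k
        + (s ^ 2 / (g - h + 1)
          + 10.5 * (g - h + 1) * Real.log g ^ 2 / (30.57 * g * η ^ 2)
          - s * ((1 / η + h) * (1 - 1 / h) ^ (s / (g - h + 1)) - h) * Real.log (1 / (10 * η)))
        + k * Real.log (5 * (rf + 1))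
        + (g - h + 1) * Real.log (16 * g * F * s))
      ≤ Real.log (9.463 - 0.002) := by
  obtain ⟨hr, hslo, hshi, hτ, hW⟩ := tail_basic hlam hk1 hrf1 hh1 hh2 hg1 hg2 hs1 hs2
  have hlam0 : 0 < lam := by linarith
  have hgh : h + 2 ≤ g := by linarith
  have hs0 : 1 ≤ s := by nlinarith
  set W : ℝ := 1 / (2 * (rf + 1) * s) with hWdef
  have h1 := tail_c8_first hlam hr hg1 hg2 hq1 hq2 hwp0 hwp2 hη
  have h2 := tail_c8_theta hlam hk1 hk2 hW
  have h3 := tail_c8_CT4 hlam hr hh1 hh2 hg1 hg2 hτ hgh hs1 hs2 hshi hq1 hq2 hη hWdef hW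
  have h4 := tail_c8_rest hlam hk1 hk2 hrf2 hr hg1 hg2 hτ hgh hs0 hshi hF0 hF hW
  have h5 := log_9461_ge
  have e : W * (2.3291 * k ^ 3 * Real.log k
        + (s ^ 2 / (g - h + 1)
          + 10.5 * (g - h + 1) * Real.log g ^ 2 / (30.57 * g * η ^ 2)
          - s * ((1 / η + h) * (1 - 1 / h) ^ (s / (g - h + 1)) - h) * Real.log (1 / (10 * η)))
        + k * Real.log (5 * (rf + 1))
        + (g - h + 1) * Real.log (16 * g * F * s))
      = W * (2.3291 * k ^ 3 * Real.log k)
        + W * ((s ^ 2 / (g - h + 1)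
          + 10.5 * (g - h + 1) * Real.log g ^ 2 / (30.57 * g * η ^ 2)
          - s * ((1 / η + h) * (1 - 1 / h) ^ (s / (g - h + 1)) - h) * Real.log (1 / (10 * η))))
        + W * (k * Real.log (5 * (rf + 1)) + (g - h + 1) * Real.log (16 * g * F * s)) := by ring
  rw [e]
  linarith

/-! ### The remaining side conditions in the tail -/

/-- `log g ≥ 7.62` for `g ≥ 2048`. [folklore] -/
theorem log_ge_762 {g : ℝ} (hg : 2048 ≤ g) : 7.62 ≤ Real.log g := by
  have h1 : Real.log 2048 ≤ Real.log g := Real.log_le_log (by norm_num) hg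
  have h2 : Real.log 2048 = 11 * Real.log 2 := by
    rw [show (2048 : ℝ) = 2 ^ 11 by norm_num, Real.log_pow]; norm_num
  have h3 := Real.log_two_gt_d9
  linarith

/-- **Condition (1.10) of Theorem 4 in the tail** (`c4a`–`c4d`) for `η = 1/(7gq)`, `q = ⌊√g⌋ ≥ 50`.
[cite: Ford2002, (1.10), (5.16)] -/
theorem tail_c4 {g q η : ℝ} (hg : 2500 ≤ g) (hq1 : 50 ≤ q) (hq2 : q ^ 2 ≤ g) (hq3 : g < (q + 1) ^ 2)
    (hη : η * (7 * g * q) = 1) :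
    2 / g ^ 3 < η ∧ η ≤ 1 / (2 * g) ∧ 18 / g ≤ 4 * Real.log g / (30.57 * g ^ 2 * η)
      ∧ 4 * Real.log g / (30.57 * g ^ 2 * η) ≤ 0.4 := by
  have hg0 : 0 < g := by linarith
  have hq0 : 0 < q := by linarith
  have hgq : 0 < 7 * g * q := by positivity
  have hηeq : η = 1 / (7 * g * q) := by rw [eq_div_iff hgq.ne']; exact hη
  have hlogg : 7.62 ≤ Real.log g := log_ge_762 (by linarith)
  have e4 : 4 * Real.log g / (30.57 * g ^ 2 * η) = 28 * q * Real.log g / (30.57 * g) := by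
    rw [hηeq]; field_simp; ring
  refine ⟨?_, ?_, ?_, ?_⟩
  · rw [hηeq, div_lt_div_iff₀ (by positivity) hgq]
    nlinarith [mul_le_mul_of_nonneg_left hq1 hg0.le]
  · rw [hηeq]; exact one_div_le_one_div_of_le (by positivity) (by nlinarith)
  · rw [e4, div_le_div_iff₀ hg0 (by positivity)]
    have : 18 * 30.57 ≤ 28 * q * Real.log g := by nlinarith [mul_le_mul hq1 hlogg (by norm_num) hq0.le]
    nlinarith [this]
  · rw [e4, div_le_iff₀ (by positivity)]
    -- `log g < 2 log(q+1) ≤ 2(4.159 + (q-50)/51) ≤ 0.4367 q`, and `g ≥ q²`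
    have hq1' : 0 < q + 1 := by linarith
    have hlg : Real.log g ≤ 2 * Real.log (q + 1) := by
      have := Real.log_le_log hg0 hq3.le
      rwa [Real.log_pow, Nat.cast_ofNat] at this
    have hlq : Real.log (q + 1) ≤ 4.16 + ((q + 1) / 51 - 1) := by
      have e : Real.log (q + 1) = Real.log 51 + Real.log ((q + 1) / 51) := by
        rw [← Real.log_mul (by norm_num) (by positivity)]; congr 1; field_simp
      have h51 : Real.log 51 ≤ 4.16 := by
        have a : Real.log 51 ≤ Real.log 64 := Real.log_le_log (by norm_num) (by norm_num)
        rw [show (64 : ℝ) = 2 ^ 6 by norm_num, Real.log_pow] at a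
        have := Real.log_two_lt_d9
        push_cast at a; linarith
      have h2 : Real.log ((q + 1) / 51) ≤ (q + 1) / 51 - 1 := Real.log_le_sub_one_of_pos (by positivity)
      linarith
    have hmain : 28 * q * Real.log g ≤ 0.4 * (30.57 * q ^ 2) := by
      have a : Real.log g ≤ 0.4367 * q := by linarith
      have := mul_le_mul_of_nonneg_left a (show 0 ≤ 28 * q by positivity)
      nlinarith [this]
    nlinarith [hmain, hq2]

/-- `c5a` in the tail: `80 ≤ η · 48.09λ²` for `η = 1/(7gq)`. [cite: Ford2002, Lemma 5.1 hypothesis `R ≥ e^80`] -/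
theorem tail_c5a {lam g q η : ℝ} (hlam : 2025 ≤ lam) (hg1 : 1.2450 * lam ≤ g) (hg2 : g ≤ 1.2456 * lam)
    (hq0 : 0 < q) (hq2 : q ^ 2 ≤ g) (hη : η * (7 * g * q) = 1) :
    80 ≤ η * (0.1603 * 300 * lam ^ 2) := by
  have hlam0 : 0 < lam := by linarith
  have hg0 : 0 < g := by linarith
  have hgq : 0 < 7 * g * q := by positivity
  have hηeq : η = 1 / (7 * g * q) := by rw [eq_div_iff hgq.ne']; exact hη
  obtain ⟨hρ1, hρ4, hsq⟩ := root_props hlam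
  -- `g q ≤ 1.3903 λ √λ` as in `tail_c8_first`
  have hqs : q ≤ Real.sqrt g := (Real.le_sqrt' hq0).2 hq2
  have hsg : Real.sqrt g ≤ 1.1161 * Real.sqrt lam := by
    rw [show (1.1161 : ℝ) * Real.sqrt lam = Real.sqrt (1.1161 ^ 2 * lam) by
      rw [Real.sqrt_mul' _ hlam0.le, Real.sqrt_sq (by norm_num)]]
    refine Real.sqrt_le_sqrt ?_
    have : (1.1161 : ℝ) ^ 2 = 1.24567921 := by norm_num
    rw [this]; linarith
  have hsl0 : 0 ≤ Real.sqrt lam := Real.sqrt_nonneg _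
  have hgq_le : g * q ≤ 1.3903 * lam * Real.sqrt lam := by
    have h1 : q ≤ 1.1161 * Real.sqrt lam := hqs.trans hsg
    have h2 := mul_le_mul hg2 h1 hq0.le (by positivity)
    have h3 : 1.2456 * lam * (1.1161 * Real.sqrt lam) ≤ 1.3903 * lam * Real.sqrt lam := by
      have : 0 ≤ lam * Real.sqrt lam := by positivity
      nlinarith [this]
    linarith
  have h45 : 45 ≤ Real.sqrt lam := by rw [hsq]; nlinarith
  have hsq2 : Real.sqrt lam ^ 2 = lam := Real.sq_sqrt hlam0.le
  rw [hηeq, div_mul_eq_mul_div, one_mul, le_div_iff₀ hgq]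
  -- `560 g q ≤ 48.09 λ²`
  nlinarith [hgq_le, h45, hsq2, mul_le_mul_of_nonneg_left h45 (by positivity : (0:ℝ) ≤ lam * Real.sqrt lam)]

/-- `η = 1/(7gq) ≤ (2/16.3) λ^{-3/2}` in the tail. [cite: Ford2002, (5.22)] -/
theorem tail_eta_le {lam g q η : ℝ} (hlam : 2025 ≤ lam) (hg1 : 1.2450 * lam ≤ g) (hg2 : g ≤ 1.2456 * lam)
    (hq0 : 0 < q) (hq3 : g < (q + 1) ^ 2) (hη : η * (7 * g * q) = 1) :
    η ≤ 2 / 16.3 * (lam ^ (-(1 : ℝ) / 2)) ^ 3 := by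
  have hlam0 : 0 < lam := by linarith
  have hg0 : 0 < g := by linarith
  have hgq : 0 < 7 * g * q := by positivity
  have hηeq : η = 1 / (7 * g * q) := by rw [eq_div_iff hgq.ne']; exact hη
  -- `w = λ^{-1/2}`, `w² λ = 1`, `w > 0`; target `1/(7gq) ≤ (2/16.3) w³` iff `λ√λ·16.3 ≤ 14 g q`…
  obtain ⟨w, hw⟩ : ∃ x : ℝ, x = lam ^ (-(1 : ℝ) / 2) := ⟨_, rfl⟩
  rw [← hw]
  have hw2 : w ^ 2 = 1 / lam := by
    rw [hw, ← Real.rpow_natCast, ← Real.rpow_mul hlam0.le]; norm_num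
    rw [Real.rpow_neg hlam0.le, Real.rpow_one]
  have hw0 : 0 < w := by rw [hw]; exact Real.rpow_pos_of_pos hlam0 _
  -- `√g > q`, so `q + 1 > √g ≥ √(1.245 λ)`; and `√λ = 1/(w λ)·λ = 1/w`… use `s := √lam = 1/w`
  have hs : Real.sqrt lam = 1 / w := by
    rw [eq_div_iff hw0.ne', ← sub_eq_zero]
    have h1 : (Real.sqrt lam * w) ^ 2 = 1 := by rw [mul_pow, Real.sq_sqrt hlam0.le, hw2]; field_simp
    have h2 : 0 ≤ Real.sqrt lam * w := by positivity
    nlinarith [h1, h2]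
  have hq1 : Real.sqrt g - 1 < q := by
    have : Real.sqrt g < q + 1 := by
      rw [show q + 1 = Real.sqrt ((q + 1) ^ 2) by rw [Real.sqrt_sq (by linarith)]]
      exact Real.sqrt_lt_sqrt hg0.le hq3
    linarith
  have hsg : 1.1157 * Real.sqrt lam ≤ Real.sqrt g := by
    rw [show (1.1157 : ℝ) * Real.sqrt lam = Real.sqrt (1.1157 ^ 2 * lam) by
      rw [Real.sqrt_mul' _ hlam0.le, Real.sqrt_sq (by norm_num)]]
    refine Real.sqrt_le_sqrt ?_
    have : (1.1157 : ℝ) ^ 2 = 1.24478649 := by norm_num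
    rw [this]; linarith
  have h45 : 45 ≤ Real.sqrt lam := by
    rw [show (45 : ℝ) = Real.sqrt (45 ^ 2) by rw [Real.sqrt_sq (by norm_num)]]
    exact Real.sqrt_le_sqrt (by nlinarith)
  -- `14 g q ≥ 14 g (1.1157√λ − 1) ≥ 16.3 λ √λ`
  have hkey : 16.3 * lam * Real.sqrt lam ≤ 14 * g * q := by
    have a : 14 * g * (1.1157 * Real.sqrt lam - 1) ≤ 14 * g * q :=
      mul_le_mul_of_nonneg_left (by linarith) (by positivity)
    have b : 16.3 * lam * Real.sqrt lam ≤ 14 * g * (1.1157 * Real.sqrt lam - 1) := by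
      nlinarith [mul_le_mul_of_nonneg_right hg1 (Real.sqrt_nonneg lam), h45, hg2]
    linarith
  rw [hηeq, div_le_iff₀ hgq]
  -- `1 ≤ (2/16.3) w³ · 7 g q`, using `w³ λ√λ = 1`
  have hwl : w ^ 2 * lam = 1 := by rw [hw2]; field_simp
  have hw3 : w ^ 3 * (lam * Real.sqrt lam) = 1 := by
    rw [hs]
    calc w ^ 3 * (lam * (1 / w)) = w ^ 2 * lam := by field_simp
      _ = 1 := hwl
  -- `1 = w³ λ√λ ≤ w³ (14 g q/16.3)`
  have hw30 : 0 < w ^ 3 := pow_pos hw0 3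
  have := mul_le_mul_of_nonneg_left hkey hw30.le
  nlinarith [this, hw3]

/-- **The exponent condition `c9` in the tail** at `λ* = λ`, from the box certificate.
[cite: Ford2002, (5.22), (5.31)] -/
theorem tail_c9 (hbox : checkAll = true) {lam k rf h g s m₁ m₂ η : ℝ} (hlam : 2025 ≤ lam)
    (hk1 : lam * (2500 / 1623 - 1 / lam) ≤ k) (hk2 : k ≤ lam * (2500 / 1623 + 3 / 1000000 * (1 / lam)))
    (hrf1 : 3.21432 * k ^ 2 - 1 ≤ rf) (hrf2 : rf ≤ 3.21432 * k ^ 2)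
    (hh : 1 ≤ h) (hgh : h + 2 ≤ g)
    (hs1 : 0.3299 * h * (g - h) ≤ s) (hs2 : s ≤ 0.3299 * h * (g - h) + 1)
    (hη : η ≤ 2 / 16.3 * (lam ^ (-(1 : ℝ) / 2)) ^ 3)
    (hm1a : m₁ ≤ lam / (1 - 0.1905)) (hm1b : lam / (1 - 0.1905) < m₁ + 1)
    (hm2a : m₂ ≤ lam / (1 - 0.1603)) (hm2b : lam / (1 - 0.1603) < m₂ + 1)
    (hu1 : 1.1818 - 1 / 4050 ≤ h / lam) (hu2 : h / lam ≤ 1.1818 + 1 / 4050)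
    (hd1 : 0.0635 - 1 / 2025 ≤ (g - h) / lam) (hd2 : (g - h) / lam ≤ 0.0635 + 1 / 2025) :
    Real.log (300 * lam ^ 2) / (300 * lam ^ 2) / (rf + 1)
      + (0.1905 * (0.001 * k ^ 2)
          + 0.1603 * ((g - h + 1) * (g - h) / 2 + η * s ^ 2 / (2 * (g - h + 1))
            + h * (g - h + 1) * Real.exp (-s / (h * (g - h + 1))))
          - (((m₂ - h + 1) * (h + m₂) / 2 + 0.1603 * ((m₁ - m₂) * (m₂ + 1 + m₁) / 2)
              - (1 - 0.1905 - 0.1603) * ((g - m₁) * (m₁ + 1 + g) / 2))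
            + ((g - m₁) - (m₂ + 1 - h)) * lam))
        / (2 * (rf + 1) * s)
      + 1 / (133.66 * lam ^ 2) ≤ 0 := by
  have hlam0 : 0 < lam := by linarith
  rw [sum_closed_form hlam0.ne']
  -- the `B`-term
  obtain ⟨b1a, b1b⟩ := beta_term_bounds (β := lam / (1 - 0.1905) - m₁) (c := 1 - 0.1905)
    (by linarith) (by linarith) (by norm_num)
  obtain ⟨b2a, b2b⟩ := beta_term_bounds (β := lam / (1 - 0.1603) - m₂) (c := 1 - 0.1603)
    (by linarith) (by linarith) (by norm_num)
  -- the box certificate at `(u, d, w)`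
  have hw0 : 0 < lam ^ (-(1 : ℝ) / 2) := Real.rpow_pos_of_pos hlam0 _
  have hw2 : (lam ^ (-(1 : ℝ) / 2)) ^ 2 = 1 / lam := by
    rw [← Real.rpow_natCast, ← Real.rpow_mul hlam0.le]; norm_num
    rw [Real.rpow_neg hlam0.le, Real.rpow_one]
  have hw1 : lam ^ (-(1 : ℝ) / 2) ≤ 1 / 45 := by
    have : (lam ^ (-(1 : ℝ) / 2)) ^ 2 ≤ (1 / 45) ^ 2 := by
      rw [hw2, div_pow, one_pow]
      refine one_div_le_one_div_of_le (by norm_num) ?_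
      norm_num; linarith
    exact le_of_pow_le_pow_left₀ (by norm_num) (by norm_num) this
  obtain ⟨hn, hF⟩ := box_point hbox hu1 hu2 hd1 hd2 hw0.le hw1
  have hB1 : ((lam / (1 - 0.1905) - m₁) * (1 - (lam / (1 - 0.1905) - m₁)) * (1 - 0.1905)
      + (lam / (1 - 0.1603) - m₂) * (1 - (lam / (1 - 0.1603) - m₂)) * (1 - 0.1603)) / 2 ≤ 4123 / 20000 := by
    norm_num at b1b b2b ⊢; linarith
  exact c9_reduction hlam hk1 hk2 (by linarith) (by linarith) hh hgh hs1 hs2 hη hB1 hn hF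

/-- `c2e` in the tail: `s ≤ ⌊h/2⌋ (g − h + 1)` in `ℕ`. [cite: Ford2002, Theorem 4 hypotheses] -/
theorem tail_c2e {h g s : ℕ} (hh : 54 ≤ (h : ℝ)) (hgh : (h : ℝ) + 2 ≤ g)
    (hs2 : (s : ℝ) ≤ 0.3299 * h * ((g : ℝ) - h) + 1) : s ≤ h / 2 * (g - h + 1) := by
  have hhg : h ≤ g := by
    have : (h : ℝ) ≤ g := by linarith
    exact_mod_cast this
  have hdiv : ((h : ℝ) - 1) / 2 ≤ ((h / 2 : ℕ) : ℝ) := by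
    have h1 : 2 * (h / 2) + h % 2 = h := Nat.div_add_mod h 2
    have h2 : h % 2 < 2 := Nat.mod_lt _ (by norm_num)
    have h3 : (h : ℝ) ≤ 2 * ((h / 2 : ℕ) : ℝ) + 1 := by
      have : h ≤ 2 * (h / 2) + 1 := by omega
      exact_mod_cast this
    linarith
  have key : (s : ℝ) ≤ ((h / 2 : ℕ) : ℝ) * ((g : ℝ) - h + 1) := by
    have hτ0 : 0 ≤ (g : ℝ) - h + 1 := by linarith
    have a : ((h : ℝ) - 1) / 2 * ((g : ℝ) - h + 1) ≤ ((h / 2 : ℕ) : ℝ) * ((g : ℝ) - h + 1) :=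
      mul_le_mul_of_nonneg_right hdiv hτ0
    have b : 0.3299 * h * ((g : ℝ) - h) + 1 ≤ ((h : ℝ) - 1) / 2 * ((g : ℝ) - h + 1) := by
      nlinarith [mul_le_mul_of_nonneg_right (show (54 : ℝ) ≤ h from hh) (show (0:ℝ) ≤ (g:ℝ) - h by linarith)]
    linarith
  have : ((s : ℕ) : ℝ) ≤ ((h / 2 * (g - h + 1) : ℕ) : ℝ) := by
    push_cast [Nat.cast_sub hhg]
    exact key
  exact_mod_cast this

/-- **Theorem 2 of [Ford2002] in the tail `λ = log t/log N ≥ 2025`** (from the rows of (1.7) with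
`k ≥ 200`, Theorem 4, and the box certificate `Tail.checkAll`): for `1 ≤ N < R₀ ≤ 2N`, `0 < u ≤ 1`,
`t ≥ N^{2025}`,
`|∑_{N<n≤R₀} (n+u)^{-it}| ≤ 9.463 · N^{1 − log²N/(133.66 log²t)}`.
The parameters are Ford's: `k = ⌊λ/κ + 3·10⁻⁶⌋`, `h = ⌊γ₀λ + ½⌋`, `g = ⌊(γ₀+δ₀)λ + ½⌋`, `s = ⌊σh(g−h)⌋ + 1`,
`η = 1/(7g⌊√g⌋)`, `w⁺ = ⌈182 g⌊√g⌋/25⌉`. [cite: Ford2002, Theorem 2, §5 (5.13)–(5.31), Lemma 5.2] -/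
theorem expSum_bound_lambda_ge_2025
    (hT3a : ∀ k : ℕ, 200 ≤ k → ∃ s₃ : ℕ, 1 ≤ s₃ ∧ (s₃ : ℝ) ≤ 3.21432 * (k : ℝ) ^ 2 ∧ ∀ P : ℕ, 1 ≤ P →
      (VMV.J k s₃ (Finset.Icc (1 : ℤ) P) : ℝ) ≤ (k : ℝ) ^ (2.3291 * (k : ℝ) ^ 3)
        * (P : ℝ) ^ ((2 * s₃ : ℝ) - ((k * (k + 1) / 2 : ℕ) : ℝ) + 0.001 * (k : ℝ) ^ 2))
    (hT4 : ∀ (k h s : ℕ) (P η D : ℝ), 60 ≤ k → (0.9 : ℝ) * k ≤ h → h + 2 ≤ k →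
      2 * (k - h + 1) ≤ s → s ≤ (h / 2) * (k - h + 1) → 10 ≤ D → Real.exp (D * (k : ℝ) ^ 2) ≤ P →
      2 / (k : ℝ) ^ 3 < η → η ≤ 1 / (2 * (k : ℝ)) →
      18 / (k : ℝ) ≤ 4 * Real.log k / (D * (k : ℝ) ^ 2 * η) →
      4 * Real.log k / (D * (k : ℝ) ^ 2 * η) ≤ 0.4 →
      (Jinc k s ((calC P (P ^ η)).map Nat.castEmbedding) h k : ℝ)
        ≤ Real.exp ((s : ℝ) ^ 2 / ((k : ℝ) - h + 1)
            + 10.5 * ((k : ℝ) - h + 1) * Real.log k ^ 2 / (D * k * η ^ 2)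
            - s * ((1 / η + h) * (1 - 1 / (h : ℝ)) ^ ((s : ℝ) / ((k : ℝ) - h + 1)) - h)
              * Real.log (1 / (10 * η)))
          * P ^ ((2 * s : ℝ) - ((k : ℝ) - h + 1) / 2 * (h + k) + ((k : ℝ) - h + 1) * ((k : ℝ) - h) / 2
            + η * (s : ℝ) ^ 2 / (2 * ((k : ℝ) - h + 1))
            + h * ((k : ℝ) - h + 1) * Real.exp (-(s : ℝ) / (h * ((k : ℝ) - h + 1)))))
    (hbox : checkAll = true)
    {N R₀ : ℕ} {t u : ℝ} (hN : 1 ≤ N) (hNR : N < R₀) (hR : R₀ ≤ 2 * N) (hu0 : 0 < u) (hu1 : u ≤ 1)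
    (ht1 : (N : ℝ) ^ (2025 : ℕ) ≤ t) :
    ‖∑ n ∈ Ioc N R₀, ((n : ℂ) + u) ^ (-(t * Complex.I))‖
      ≤ 9.463 * (N : ℝ) ^ (1 - Real.log N ^ 2 / (133.66 * Real.log t ^ 2)) := by
  have hS := norm_shifted_sum_le_trivial hR hu0 (t := t)
  rcases eq_or_lt_of_le hN with hN1 | hN2
  · subst hN1
    simp only [Nat.cast_one, Real.one_rpow, mul_one] at hS ⊢
    exact hS.trans (by norm_num)
  have hN0 : (0 : ℝ) < N := by positivity
  have hN1' : (1 : ℝ) < N := by exact_mod_cast hN2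
  have hL : 0 < Real.log N := Real.log_pos hN1'
  have hNpow : (1 : ℝ) < (N : ℝ) ^ (2025 : ℕ) := one_lt_pow₀ hN1' (by norm_num)
  have ht1' : 1 < t := lt_of_lt_of_le hNpow ht1
  have ht0 : 0 < t := by linarith only [ht1']
  have hlog1 : (2025 : ℝ) * Real.log N ≤ Real.log t := by
    have := Real.log_le_log (by positivity) ht1
    rwa [Real.log_pow, Nat.cast_ofNat] at this
  by_cases hsmall : Real.log N ^ 3 ≤ 300 * Real.log t ^ 2
  · exact (expSum_bound_trivial_range hN hR hu0 ht1' hsmall).trans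
      (mul_le_mul_of_nonneg_right (by norm_num) (by positivity))
  push Not at hsmall
  have hbig : 300 * (Real.log t / Real.log N) ^ 2 ≤ Real.log N := by
    rw [div_pow, ← mul_div_assoc, div_le_iff₀ (pow_pos hL 2)]
    nlinarith only [hsmall]
  obtain ⟨lam, hlam⟩ : ∃ x : ℝ, x = Real.log t / Real.log N := ⟨_, rfl⟩
  have hl25 : 2025 ≤ lam := by rw [hlam, le_div_iff₀ hL]; exact hlog1
  have hlam0 : 0 < lam := by linarith only [hl25]
  -- ### the parameters
  obtain ⟨kN, hkN⟩ : ∃ n : ℕ, n = ⌊lam / 0.6492 + 3 / 1000000⌋₊ := ⟨_, rfl⟩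
  obtain ⟨hh, hhh⟩ : ∃ n : ℕ, n = ⌊1.1818 * lam + 1 / 2⌋₊ := ⟨_, rfl⟩
  obtain ⟨gN, hgN⟩ : ∃ n : ℕ, n = ⌊1.2453 * lam + 1 / 2⌋₊ := ⟨_, rfl⟩
  obtain ⟨m1, hm1⟩ : ∃ n : ℕ, n = ⌊lam / (1 - 0.1905)⌋₊ := ⟨_, rfl⟩
  obtain ⟨m2, hm2⟩ : ∃ n : ℕ, n = ⌊lam / (1 - 0.1603)⌋₊ := ⟨_, rfl⟩
  obtain ⟨qN, hqN⟩ : ∃ n : ℕ, n = Nat.sqrt gN := ⟨_, rfl⟩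
  obtain ⟨sN, hsN⟩ : ∃ n : ℕ, n = ⌊0.3299 * (hh : ℝ) * ((gN : ℝ) - hh)⌋₊ + 1 := ⟨_, rfl⟩
  obtain ⟨wpN, hwpN⟩ : ∃ n : ℕ, n = (182 * gN * qN + 24) / 25 := ⟨_, rfl⟩
  obtain ⟨η, hη⟩ : ∃ x : ℝ, x = 1 / (7 * (gN : ℝ) * qN) := ⟨_, rfl⟩
  -- ### real windows
  have e6492 : lam / 0.6492 = lam * (2500 / 1623) := by rw [div_eq_mul_one_div]; norm_num
  have hk_lo : lam / 0.6492 + 3 / 1000000 < (kN : ℝ) + 1 := by rw [hkN]; exact Nat.lt_floor_add_one _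
  have hk_hi : (kN : ℝ) ≤ lam / 0.6492 + 3 / 1000000 := by rw [hkN]; exact Nat.floor_le (by positivity)
  rw [e6492] at hk_lo hk_hi
  have hk1 : lam * (2500 / 1623 - 1 / lam) ≤ kN := by
    have e : lam * (2500 / 1623 - 1 / lam) = lam * (2500 / 1623) - 1 := by field_simp
    rw [e]; linarith only [hk_lo]
  have hk2 : (kN : ℝ) ≤ lam * (2500 / 1623 + 3 / 1000000 * (1 / lam)) := by
    have e : lam * (2500 / 1623 + 3 / 1000000 * (1 / lam)) = lam * (2500 / 1623) + 3 / 1000000 := by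
      field_simp
    rw [e]; exact hk_hi
  have hk1' : 1.5398 * lam ≤ kN := by linarith only [hk_lo, hl25]
  have hk2' : (kN : ℝ) ≤ 1.5405 * lam := by linarith only [hk_hi, hl25]
  have hh_lo : 1.1818 * lam + 1 / 2 < (hh : ℝ) + 1 := by rw [hhh]; exact Nat.lt_floor_add_one _
  have hh_hi : (hh : ℝ) ≤ 1.1818 * lam + 1 / 2 := by rw [hhh]; exact Nat.floor_le (by positivity)
  have hg_lo : 1.2453 * lam + 1 / 2 < (gN : ℝ) + 1 := by rw [hgN]; exact Nat.lt_floor_add_one _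
  have hg_hi : (gN : ℝ) ≤ 1.2453 * lam + 1 / 2 := by rw [hgN]; exact Nat.floor_le (by positivity)
  have hh1 : 1.1815 * lam ≤ hh := by linarith only [hh_lo, hl25]
  have hh2 : (hh : ℝ) ≤ 1.1821 * lam := by linarith only [hh_hi, hl25]
  have hg1 : 1.2450 * lam ≤ gN := by linarith only [hg_lo, hl25]
  have hg2 : (gN : ℝ) ≤ 1.2456 * lam := by linarith only [hg_hi, hl25]
  have hgh : (hh : ℝ) + 2 ≤ gN := by linarith only [hh2, hg1, hl25]
  have hhg : hh ≤ gN := by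
    have : (hh : ℝ) ≤ gN := by linarith only [hgh]
    exact_mod_cast this
  have hgh0 : (0 : ℝ) ≤ (gN : ℝ) - hh := by linarith only [hgh]
  have hX0 : 0 ≤ 0.3299 * (hh : ℝ) * ((gN : ℝ) - hh) := by positivity
  have hsR : (sN : ℝ) = (⌊0.3299 * (hh : ℝ) * ((gN : ℝ) - hh)⌋₊ : ℝ) + 1 := by rw [hsN]; push_cast; ring
  have hs1 : 0.3299 * (hh : ℝ) * ((gN : ℝ) - hh) ≤ sN := by
    rw [hsR]; exact (Nat.lt_floor_add_one _).le
  have hs2 : (sN : ℝ) ≤ 0.3299 * (hh : ℝ) * ((gN : ℝ) - hh) + 1 := by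
    rw [hsR]; linarith only [Nat.floor_le hX0]
  have hm1a : (m1 : ℝ) ≤ lam / (1 - 0.1905) := by
    rw [hm1]; exact Nat.floor_le (div_nonneg hlam0.le (by norm_num))
  have hm1b : lam / (1 - 0.1905) < (m1 : ℝ) + 1 := by rw [hm1]; exact Nat.lt_floor_add_one _
  have hm2a : (m2 : ℝ) ≤ lam / (1 - 0.1603) := by
    rw [hm2]; exact Nat.floor_le (div_nonneg hlam0.le (by norm_num))
  have hm2b : lam / (1 - 0.1603) < (m2 : ℝ) + 1 := by rw [hm2]; exact Nat.lt_floor_add_one _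
  -- `q = ⌊√g⌋`
  have hg2500 : 2500 ≤ gN := by
    have : (2500 : ℝ) ≤ gN := by linarith only [hg1, hl25]
    exact_mod_cast this
  have hq50 : 50 ≤ qN := by rw [hqN, Nat.le_sqrt]; omega
  have hq2N : qN ^ 2 ≤ gN := by rw [hqN]; exact Nat.sqrt_le' gN
  have hq3N : gN < (qN + 1) ^ 2 := by rw [hqN]; exact Nat.lt_succ_sqrt' gN
  have hq50r : (50 : ℝ) ≤ qN := by exact_mod_cast hq50
  have hq2 : (qN : ℝ) ^ 2 ≤ gN := by exact_mod_cast hq2N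
  have hq3 : (gN : ℝ) < ((qN : ℝ) + 1) ^ 2 := by exact_mod_cast hq3N
  have hq0 : (0 : ℝ) < qN := by linarith only [hq50r]
  have hg0 : (0 : ℝ) < gN := by linarith only [hg1, hl25]
  -- `η`, `w⁺`
  have hgq : (0 : ℝ) < 7 * (gN : ℝ) * qN := by positivity
  have hηeq : η * (7 * (gN : ℝ) * qN) = 1 := by rw [hη]; field_simp
  have hη0 : 0 < η := by rw [hη]; positivity
  have hηinv : 1 / η = 7 * (gN : ℝ) * qN := by rw [hη, one_div_one_div]
  have hwp_nat : 182 * gN * qN ≤ 25 * wpN ∧ 25 * wpN ≤ 182 * gN * qN + 24 := by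
    rw [hwpN]; constructor <;> omega
  have hwp1 : 182 * (gN : ℝ) * qN / 25 ≤ wpN := by
    rw [div_le_iff₀ (by norm_num)]
    have : ((182 * gN * qN : ℕ) : ℝ) ≤ ((25 * wpN : ℕ) : ℝ) := by exact_mod_cast hwp_nat.1
    push_cast at this
    linarith only [this]
  have hwp2 : (wpN : ℝ) ≤ 182 * (gN : ℝ) * qN / 25 + 1 := by
    have : ((25 * wpN : ℕ) : ℝ) ≤ ((182 * gN * qN + 24 : ℕ) : ℝ) := by exact_mod_cast hwp_nat.2
    push_cast at this
    linarith only [this]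
  have hwp0 : (1 : ℝ) ≤ wpN := by
    have : (25 : ℝ) ≤ 182 * (gN : ℝ) * qN := by nlinarith only [hg0, hq50r, hg1, hl25]
    linarith only [this, hwp1]
  -- `r_f = ⌊ρk²⌋`
  have hrf1 : 3.21432 * (kN : ℝ) ^ 2 - 1 ≤ (⌊3.21432 * (kN : ℝ) ^ 2⌋₊ : ℝ) := by
    linarith only [Nat.lt_floor_add_one (3.21432 * (kN : ℝ) ^ 2)]
  have hrf2 : (⌊3.21432 * (kN : ℝ) ^ 2⌋₊ : ℝ) ≤ 3.21432 * (kN : ℝ) ^ 2 := Nat.floor_le (by positivity)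
  obtain ⟨hr762, _, hshi, _, _⟩ := tail_basic hl25 hk1' hrf1 hh1 hh2 hg1 hg2 hs1 hs2
  -- ### (1.10)
  obtain ⟨c4a, c4b, c4c, c4d⟩ := tail_c4 (by exact_mod_cast hg2500) hq50r hq2 hq3 hηeq
  -- ### the constant condition
  have hF : Real.log ((4 : ℝ) ^ gN) = (gN : ℝ) * Real.log 4 := by rw [Real.log_pow]
  have c8 := tail_c8 (F := (4 : ℝ) ^ gN) hl25 hk1' hk2' hrf1 hrf2 hh1 hh2 hg1 hg2 hs1 hs2 hq50r hq2 hwp0 hwp2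
    hηeq (by positivity) hF
  have hk200 : 200 ≤ kN := by
    have : (200 : ℝ) ≤ kN := by linarith only [hk1', hl25]
    exact_mod_cast this
  -- ### apply the interval theorem
  refine sec5_interval (k := kN) (h := hh) (g := gN) (s := sN) (m₁ := m1) (m₂ := m2) (wp := wpN)
    (lamlo := lam) (lamhi := lam) (η := η) (ρ := 3.21432) (θ := 2.3291) (Ctar := 9.463)
    (hT3a kN hk200) hT4
    (by linarith only [hl25]) le_rfl hη0 (by norm_num)
    ?c1 ?c2a ?c2b ?c2c ?c2d ?c2e ?c3 c4a c4b c4c c4d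
    (tail_c5a hl25 hg1 hg2 hq0 hq2 hηeq) ?c5b ?c5c ?c6a ?c6b ?c6c ?c6d ?c6e ?c6f ?c6g ?c7a ?c7b ?c7c
    c8 ?c9 hN2 hNR hR hu0 hu1 ht0 ?hlo ?hhi hbig
  case c1 =>
    have e : 0.6492 * (lam * (2500 / 1623) + 3 / 1000000) = lam + 0.6492 * 3 / 1000000 := by norm_num; ring
    have := mul_lt_mul_of_pos_left hk_lo (by norm_num : (0:ℝ) < 0.6492)
    rw [e] at this
    linarith only [this]
  case c2a =>
    have : (60 : ℝ) ≤ gN := by linarith only [hg1, hl25]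
    exact_mod_cast this
  case c2b => linarith only [hh1, hg2, hl25]
  case c2c => exact_mod_cast hgh
  case c2d =>
    have key : ((2 * (gN - hh + 1) : ℕ) : ℝ) ≤ sN := by
      push_cast [Nat.cast_sub hhg]
      have t1 : 1.1815 * lam * ((gN : ℝ) - hh) ≤ (hh : ℝ) * ((gN : ℝ) - hh) :=
        mul_le_mul_of_nonneg_right hh1 hgh0
      nlinarith only [t1, hgh, hl25, hs1, hgh0]
    exact_mod_cast key
  case c2e => exact tail_c2e (by linarith only [hh1, hl25]) hgh hs2
  case c3 => nlinarith only [hg2, hg0, hl25]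
  case c5b => rw [hηinv]; nlinarith only [hg0, hq50r, hg1, hl25]
  case c5c =>
    rw [hηinv]
    have : 26 * (7 * (gN : ℝ) * qN) / 25 = 182 * (gN : ℝ) * qN / 25 := by ring
    rw [this]; exact hwp1
  case c6a =>
    have : (hh : ℝ) ≤ (m2 : ℝ) + 1 := by
      have e : lam / (1 - 0.1603) = lam * (10000 / 8397) := by rw [div_eq_mul_one_div]; norm_num
      rw [e] at hm2b; linarith only [hm2b, hh_hi, hl25]
    exact_mod_cast this
  case c6b =>
    rw [hm1, hm2]
    exact Nat.floor_le_floor (div_le_div_of_nonneg_left hlam0.le (by norm_num) (by norm_num))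
  case c6c =>
    have : (m1 : ℝ) ≤ gN := by
      have e : lam / (1 - 0.1905) = lam * (10000 / 8095) := by rw [div_eq_mul_one_div]; norm_num
      rw [e] at hm1a; linarith only [hm1a, hg_lo, hl25]
    exact_mod_cast this
  case c6d => exact (le_div_iff₀ (by norm_num)).1 hm2a
  case c6e => exact ((div_lt_iff₀ (by norm_num)).1 hm2b).le
  case c6f => exact (le_div_iff₀ (by norm_num)).1 hm1a
  case c6g => exact ((div_lt_iff₀ (by norm_num)).1 hm1b).le
  case c7a =>
    have : (sN : ℝ) ≤ (⌊3.21432 * (kN : ℝ) ^ 2⌋₊ : ℝ) + 1 := by nlinarith only [hshi, hr762, hl25]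
    exact_mod_cast this
  case c7b =>
    have : (1 : ℝ) ≤ hh := by linarith only [hh1, hl25]
    exact_mod_cast this
  case c7c =>
    have : (gN : ℝ) ≤ kN := by linarith only [hg2, hk1', hl25]
    exact_mod_cast this
  case c9 =>
    intro lstar hl
    have hl' : lstar = lam := hl.elim id id
    subst hl'
    have hu1' : 1.1818 - 1 / 4050 ≤ (hh : ℝ) / lstar := by
      rw [le_div_iff₀ hlam0]; linarith only [hh_lo, hl25]
    have hu2' : (hh : ℝ) / lstar ≤ 1.1818 + 1 / 4050 := by
      rw [div_le_iff₀ hlam0]; linarith only [hh_hi, hl25]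
    have hd1' : 0.0635 - 1 / 2025 ≤ ((gN : ℝ) - hh) / lstar := by
      rw [le_div_iff₀ hlam0]; linarith only [hg_lo, hh_hi, hl25]
    have hd2' : ((gN : ℝ) - hh) / lstar ≤ 0.0635 + 1 / 2025 := by
      rw [div_le_iff₀ hlam0]; linarith only [hg_hi, hh_lo, hl25]
    exact tail_c9 hbox hl25 hk1 hk2 hrf1 hrf2 (by linarith only [hh1, hl25]) hgh hs1 hs2
      (tail_eta_le hl25 hg1 hg2 hq0 hq3 hηeq) hm1a hm1b hm2a hm2b hu1' hu2' hd1' hd2'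
  case hlo => rw [hlam, div_mul_cancel₀ _ hL.ne']
  case hhi => rw [hlam, div_mul_cancel₀ _ hL.ne']

end Tail
end FordVK
end Literature.NumberTheory.LFunctions

namespace Literature.NumberTheory.LFunctions
namespace FordVK
namespace Tail

/-- **The whole box certificate passes** (from the kernel computations of the cell files).
[cite: Ford2002, Lemma 5.2 (numerical verification)] -/
theorem checkAll_true : checkAll = true := by
  unfold checkAll nU
  rw [List.all_eq_true]
  intro i hi
  rw [List.mem_range] at hi
  interval_cases i
  · exact urow_0
  · exact urow_1
  · exact urow_2
  · exact urow_3
  · exact urow_4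
  · exact urow_5
  · exact urow_6
  · exact urow_7
  · exact urow_8
  · exact urow_9
  · exact urow_10
  · exact urow_11
  · exact urow_12
  · exact urow_13
  · exact urow_14
  · exact urow_15

/-- **Theorem 2 of [Ford2002] for `t ≥ N^{2025}`** (constant `9.463`, `B = 1/133.66`), from the rows
of (1.7) with `k ≥ 200` (Theorem 3) and Theorem 4 of the source, the box certificate being
discharged by the kernel: for `1 ≤ N < R₀ ≤ 2N`, `0 < u ≤ 1`,
`|∑_{N<n≤R₀} (n+u)^{-it}| ≤ 9.463 · N^{1 − log²N/(133.66 log²t)}`.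
[cite: Ford2002, Theorem 2, §5, Lemma 5.2] -/
theorem expSum_bound_lambda_ge_2025'
    (hT3a : ∀ k : ℕ, 200 ≤ k → ∃ s₃ : ℕ, 1 ≤ s₃ ∧ (s₃ : ℝ) ≤ 3.21432 * (k : ℝ) ^ 2 ∧ ∀ P : ℕ, 1 ≤ P →
      (VMV.J k s₃ (Finset.Icc (1 : ℤ) P) : ℝ) ≤ (k : ℝ) ^ (2.3291 * (k : ℝ) ^ 3)
        * (P : ℝ) ^ ((2 * s₃ : ℝ) - ((k * (k + 1) / 2 : ℕ) : ℝ) + 0.001 * (k : ℝ) ^ 2))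
    (hT4 : ∀ (k h s : ℕ) (P η D : ℝ), 60 ≤ k → (0.9 : ℝ) * k ≤ h → h + 2 ≤ k →
      2 * (k - h + 1) ≤ s → s ≤ (h / 2) * (k - h + 1) → 10 ≤ D → Real.exp (D * (k : ℝ) ^ 2) ≤ P →
      2 / (k : ℝ) ^ 3 < η → η ≤ 1 / (2 * (k : ℝ)) →
      18 / (k : ℝ) ≤ 4 * Real.log k / (D * (k : ℝ) ^ 2 * η) →
      4 * Real.log k / (D * (k : ℝ) ^ 2 * η) ≤ 0.4 →
      (Jinc k s ((calC P (P ^ η)).map Nat.castEmbedding) h k : ℝ)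
        ≤ Real.exp ((s : ℝ) ^ 2 / ((k : ℝ) - h + 1)
            + 10.5 * ((k : ℝ) - h + 1) * Real.log k ^ 2 / (D * k * η ^ 2)
            - s * ((1 / η + h) * (1 - 1 / (h : ℝ)) ^ ((s : ℝ) / ((k : ℝ) - h + 1)) - h)
              * Real.log (1 / (10 * η)))
          * P ^ ((2 * s : ℝ) - ((k : ℝ) - h + 1) / 2 * (h + k) + ((k : ℝ) - h + 1) * ((k : ℝ) - h) / 2
            + η * (s : ℝ) ^ 2 / (2 * ((k : ℝ) - h + 1))
            + h * ((k : ℝ) - h + 1) * Real.exp (-(s : ℝ) / (h * ((k : ℝ) - h + 1)))))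
    {N R₀ : ℕ} {t u : ℝ} (hN : 1 ≤ N) (hNR : N < R₀) (hR : R₀ ≤ 2 * N) (hu0 : 0 < u) (hu1 : u ≤ 1)
    (ht1 : (N : ℝ) ^ (2025 : ℕ) ≤ t) :
    ‖∑ n ∈ Ioc N R₀, ((n : ℂ) + u) ^ (-(t * Complex.I))‖
      ≤ 9.463 * (N : ℝ) ^ (1 - Real.log N ^ 2 / (133.66 * Real.log t ^ 2)) :=
  expSum_bound_lambda_ge_2025 hT3a hT4 checkAll_true hN hNR hR hu0 hu1 ht1

end Tail
end FordVK
end Literature.NumberTheory.LFunctions
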